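import Summits.KontsevichZagierPeriods.KontsevichZagierPeriods.Theses.GaussManinCertificates
import Literature.ModelTheory.ExponentialFields.CylindricalDecompositionProofs
import Literature.NumberTheory.Transcendental.KZLogCalculusProofs
import Literature.NumberTheory.Transcendental.KZDominatedFamilyRelations
import Literature.NumberTheory.Transcendental.KZSemiCanonicalReductionProofs

/-!
# `KZStokes` (stmt-KontsevichZagierPeriods-3012) — COMPLETE PROOF (crux strategist's evidence file)

Band Newton–Leibniz generates Stokes's formula on every bounded `ℚ`-semialgebraic domain: for
`r : KZ.IntegralRep (n + 1)` with bounded domain `σ` and a `ℚ`-semialgebraic primitive `H` on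
`closure σ`, continuous on the closure of every vertical fibre `σ_x`, vanishing on its frontier and with
fibrewise derivative `r.integrand` on its interior, `[r] ∈ KZ.relations`.

This single file (kept in one piece only because `lean check` elaborates one file; a prover should land
it as the four files named below, each ≤ 400 lines, in this order) proves the route decl
`Summit.KontsevichZagierPeriods.KontsevichZagierPeriods.Theses.GaussManinCertificates.KZStokes` through
the typed decomposition of `Cruxes/KZStokes/SPLIT.md`:

1. `Theorems/GaussManinCertificatesFibreRunsChains.lean` — `exists_maximal_chains` (ℕ-combinatorics of
   maximal chains band–section–band), the real-line frontier lemmas, `isSemialgebraic_openBand`;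
2. `Theorems/GaussManinCertificatesFibreRuns.lean` — `cellRuns` (runs over one cell of the adapted CAD),
   `assembleRuns` (flattening over the cells), `semialgebraicFibreRuns` (= registered stub
   `stub_semialgebraicFibreRuns`, piece X₁; uses the PROVED
   `Literature.ModelTheory.ExponentialFields.IsSemialgebraic.exists_cylindricalDecomposition_holds`);
3. `Theorems/GaussManinCertificatesKZStokesBand.lean` — `kzStokesBand` (= registered stub
   `stub_kzStokesBand`, piece X₂: one `KZ.newtonLeibnizRel` on a band, as `KZStokesBox_proof`);
4. `Theorems/GaussManinCertificatesKZStokesSplit.lean` — the glue `KZStokes_of_subs` and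
   `KZStokes_proof : …Theses.GaussManinCertificates.KZStokes` (closing theorem,
   `ledger workitem close stmt-KontsevichZagierPeriods-3012 --as proved --by …KZStokes_proof`).

No named fact is assumed (the cylindrical decomposition is discharged in the tree); no new definition;
axioms `propext`, `Classical.choice`, `Quot.sound` only. References: Kontsevich–Zagier 2001, §1.2
(rules 1) and 3)); Basu–Pollack–Roy 2006, Thm. 5.6 / Cor. 5.7.
-/

noncomputable section

open MeasureTheory Set Filter Topology
open Literature.ModelTheory.ExponentialFields
open Literature.NumberTheory.Transcendental

namespace Summit.KontsevichZagierPeriods.GaussManinCertificates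

/-! ### Maximal chains (combinatorics on `ℕ`) -/

/-- **Maximal chains.** For predicates `P` (bands) and `Q` (sections) on `ℕ` with `P k → 0 < k < L`,
linking `k` to `k + 1` when `P k ∧ Q k ∧ P (k + 1)`: there are finitely many index intervals
`(p_j, q_j]` (`p_j < q_j < L`) such that `P` holds on `(p_j, q_j]`, `Q` holds on `(p_j, q_j)`, the
chain cannot be extended below (`¬ (P p_j ∧ Q p_j)`) nor above (`¬ (Q q_j ∧ P (q_j + 1))`), every `k`
with `P k` lies in some `(p_j, q_j]`, and distinct intervals are disjoint. [folklore] -/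
theorem exists_maximal_chains (L : ℕ) (P Q : ℕ → Prop) (hP : ∀ k, P k → 0 < k ∧ k < L) :
    ∃ (J : ℕ) (p q : Fin J → ℕ),
      (∀ j, p j < q j) ∧ (∀ j, q j < L) ∧
      (∀ j k, p j < k → k ≤ q j → P k) ∧
      (∀ j k, p j < k → k < q j → Q k) ∧
      (∀ j, ¬ (P (p j) ∧ Q (p j))) ∧
      (∀ j, ¬ (Q (q j) ∧ P (q j + 1))) ∧
      (∀ k, P k → ∃ j, p j < k ∧ k ≤ q j) ∧
      (∀ i j, i ≠ j → q i ≤ p j ∨ q j ≤ p i) := by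
  classical
  -- `lk k`: the bands `k` and `k + 1` merge through the section `k`
  let lk : ℕ → Prop := fun k => P k ∧ Q k ∧ P (k + 1)
  have hstop : ∀ k, ∃ m, ¬ lk (k + m) := fun k =>
    ⟨L, fun h => by have := (hP _ h.2.2).2; omega⟩
  -- the end of the chain starting at `k`
  let e : ℕ → ℕ := fun k => k + Nat.find (hstop k)
  have he_not : ∀ k, ¬ lk (e k) := fun k => Nat.find_spec (hstop k)
  have he_lk : ∀ k m, k ≤ m → m < e k → lk m := by
    intro k m hkm hme
    have hlt : m - k < Nat.find (hstop k) := by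
      have : m < k + Nat.find (hstop k) := hme
      omega
    have h := Nat.find_min (hstop k) hlt
    rw [not_not] at h
    rwa [show k + (m - k) = m by omega] at h
  have he_ge : ∀ k, k ≤ e k := fun k => Nat.le_add_right _ _
  have hP_chain : ∀ k, P k → ∀ m, k ≤ m → m ≤ e k → P m := by
    intro k hk m hkm hme
    obtain ⟨d, rfl⟩ := Nat.exists_eq_add_of_le hkm
    induction d with
    | zero => simpa using hk
    | succ d ih =>
      have h1 : k + d < e k := by omega
      exact (he_lk k (k + d) (by omega) h1).2.2
  have he_of_chain : ∀ s k, s ≤ k → (∀ m, s ≤ m → m < k → lk m) → k ≤ e s := by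
    intro s k _ hch
    by_contra h
    exact he_not s (hch (e s) (he_ge s) (not_le.mp h))
  -- the starts of the chains
  let St : Finset ℕ := (Finset.range L).filter fun k => P k ∧ ¬ (P (k - 1) ∧ Q (k - 1))
  have hSt : ∀ k, k ∈ St ↔ k < L ∧ (P k ∧ ¬ (P (k - 1) ∧ Q (k - 1))) := fun k => by
    simp only [St, Finset.mem_filter, Finset.mem_range]
  -- every band of `P` lies in the chain of a start
  have hcover : ∀ k, P k → ∃ s ∈ St, s ≤ k ∧ ∀ m, s ≤ m → m < k → lk m := by
    intro k
    refine Nat.strong_induction_on k ?_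
    intro k ih hk
    by_cases hst : P (k - 1) ∧ Q (k - 1)
    · have hk1 : k - 1 < k := by have := (hP k hk).1; omega
      obtain ⟨s, hs, hsk, hch⟩ := ih (k - 1) hk1 hst.1
      refine ⟨s, hs, by omega, fun m hsm hmk => ?_⟩
      by_cases hm : m < k - 1
      · exact hch m hsm hm
      · have hm' : m = k - 1 := by omega
        subst hm'
        refine ⟨hst.1, hst.2, ?_⟩
        rw [show k - 1 + 1 = k by omega]
        exact hk
    · exact ⟨k, (hSt k).2 ⟨(hP k hk).2, hk, hst⟩, le_rfl, fun m hkm hmk => by omega⟩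
  -- enumerate the starts
  let st : Fin St.card → ℕ := fun j => (St.equivFin.symm j : ℕ)
  have hst_mem : ∀ j, st j ∈ St := fun j => (St.equivFin.symm j).2
  have hst_inj : Function.Injective st := fun i j h =>
    St.equivFin.symm.injective (Subtype.ext h)
  have hstP : ∀ j, P (st j) := fun j => ((hSt _).1 (hst_mem j)).2.1
  have hst1 : ∀ j, 1 ≤ st j := fun j => (hP _ (hstP j)).1
  refine ⟨St.card, fun j => st j - 1, fun j => e (st j), fun j => ?_, fun j => ?_, fun j k hpk hkq => ?_,
    fun j k hpk hkq => ?_, fun j => ((hSt _).1 (hst_mem j)).2.2, fun j h => ?_, fun k hk => ?_,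
    fun i j hij => ?_⟩
  · dsimp only
    have := hst1 j
    have := he_ge (st j)
    omega
  · exact (hP _ (hP_chain _ (hstP j) _ (he_ge _) le_rfl)).2
  · dsimp only at hpk hkq
    exact hP_chain _ (hstP j) k (by have := hst1 j; omega) hkq
  · dsimp only at hpk hkq
    exact (he_lk (st j) k (by have := hst1 j; omega) hkq).2.1
  · exact he_not (st j) ⟨hP_chain _ (hstP j) _ (he_ge _) le_rfl, h.1, h.2⟩
  · obtain ⟨s, hs, hsk, hch⟩ := hcover k hk
    have hsts : st (St.equivFin ⟨s, hs⟩) = s := by simp [st]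
    refine ⟨St.equivFin ⟨s, hs⟩, ?_, ?_⟩
    · dsimp only
      rw [hsts]
      have := (hP s ((hSt s).1 hs).2.1).1
      omega
    · dsimp only
      rw [hsts]
      exact he_of_chain s k hsk hch
  · dsimp only
    have hne : st i ≠ st j := fun h => hij (hst_inj h)
    have key : ∀ i j, st i < st j → e (st i) ≤ st j - 1 := by
      intro i j hlt
      have hj := (hSt _).1 (hst_mem j)
      by_contra h
      have hl := he_lk (st i) (st j - 1) (by omega) (not_le.mp h)
      exact hj.2.2 ⟨hl.1, hl.2.1⟩
    rcases lt_or_gt_of_ne hne with h | h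
    · exact Or.inl (key i j h)
    · exact Or.inr (key j i h)

/-! ### Frontier points on the real line -/

/-- The left end point `c` of an open interval `(c, d) ⊆ s` is a frontier point of `s` as soon as
`c ∉ s` or some interval `(c', c)` misses `s`. [folklore] -/
theorem mem_frontier_left_of_Ioo_subset {s : Set ℝ} {c d : ℝ} (hcd : c < d) (hsub : Ioo c d ⊆ s)
    (h : c ∉ s ∨ ∃ c', c' < c ∧ Ioo c' c ⊆ sᶜ) : c ∈ frontier s := by
  rw [frontier_eq_closure_inter_closure]
  refine ⟨closure_mono hsub ?_, ?_⟩
  · rw [closure_Ioo hcd.ne]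
    exact left_mem_Icc.2 hcd.le
  · rcases h with h | ⟨c', hc', hsub'⟩
    · exact subset_closure h
    · refine closure_mono hsub' ?_
      rw [closure_Ioo hc'.ne]
      exact right_mem_Icc.2 hc'.le

/-- The right end point `d` of an open interval `(c, d) ⊆ s` is a frontier point of `s` as soon as
`d ∉ s` or some interval `(d, d')` misses `s`. [folklore] -/
theorem mem_frontier_right_of_Ioo_subset {s : Set ℝ} {c d : ℝ} (hcd : c < d) (hsub : Ioo c d ⊆ s)
    (h : d ∉ s ∨ ∃ d', d < d' ∧ Ioo d d' ⊆ sᶜ) : d ∈ frontier s := by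
  rw [frontier_eq_closure_inter_closure]
  refine ⟨closure_mono hsub ?_, ?_⟩
  · rw [closure_Ioo hcd.ne]
    exact right_mem_Icc.2 hcd.le
  · rcases h with h | ⟨d', hd', hsub'⟩
    · exact subset_closure h
    · refine closure_mono hsub' ?_
      rw [closure_Ioo hd'.ne]
      exact left_mem_Icc.2 hd'.le

/-- An open band `{(x, t) | x ∈ S, a x < t < b x}` with `ℚ`-semialgebraic edges over `S` is
`ℚ`-semialgebraic (closed band minus the two edge graphs). [folklore] -/
theorem isSemialgebraic_openBand {n : ℕ} {S : Set (Fin n → ℝ)} {a b : (Fin n → ℝ) → ℝ}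
    (ha : IsSemialgebraicFunOn ℚ S a) (hb : IsSemialgebraicFunOn ℚ S b) :
    IsSemialgebraic ℚ {z : Fin (n + 1) → ℝ | Fin.init z ∈ S ∧
      z (Fin.last n) ∈ Ioo (a (Fin.init z)) (b (Fin.init z))} := by
  have h1 := KZlog.isSemialgebraic_band ha hb
  have h2 : IsSemialgebraic ℚ (graphOver S a) :=
    isSemialgebraicFunOn_iff_isSemialgebraic_graphOver.1 ha
  have h3 : IsSemialgebraic ℚ (graphOver S b) :=
    isSemialgebraicFunOn_iff_isSemialgebraic_graphOver.1 hb
  convert h1.diff (h2.union h3) using 1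
  ext z
  simp only [mem_setOf_eq, mem_Ioo, KZlog.mem_band, Set.mem_sdiff, mem_union, mem_graphOver_iff]
  constructor
  · rintro ⟨hS', h1, h2⟩
    exact ⟨⟨hS', h1.le, h2.le⟩, fun h => h.elim (fun h => h1.ne' h.2) fun h => h2.ne h.2⟩
  · rintro ⟨⟨hS', h1, h2⟩, h⟩
    obtain ⟨ha', hb'⟩ := not_or.mp h
    exact ⟨hS', lt_of_le_of_ne h1 fun e => ha' ⟨hS', e.symm⟩, lt_of_le_of_ne h2 fun e => hb' ⟨hS', e⟩⟩

/-! ### Runs over one base set -/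

/-- **Runs over one cell** (registered stub `stub_cellRuns` of the birth skeleton of piece
`SemialgebraicFibreRuns`, verbatim): over ONE base set `S` on which the vertical fibres of the bounded
set `σ` are uniformly `⋃_{j ∈ G} {ξ_j x} ∪ ⋃_{j ∈ B} (ξ_{j-1} x, ξ_j x)` for strictly increasing
`ℚ`-semialgebraic sections `ξ` and fixed index sets `G`, `B` (bands of `B` lying in `σ`), the maximal
chains band–section–band give finitely many open run bands over `S` with `ℚ`-semialgebraic edges, fibres
inside `σ_x` with end points on `frontier σ_x`, pairwise disjoint, exhausting `σ` over `S` up to the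
(null) graphs. [Basu–Pollack–Roy 2006, Cor. 5.7; folklore] -/
theorem cellRuns :
    ∀ (n : ℕ) (σ : Set (Fin (n + 1) → ℝ)) (S : Set (Fin n → ℝ)) (l : ℕ) (ξ : Fin l → (Fin n → ℝ) → ℝ)
      (G : Finset (Fin l)) (B : Finset (Fin (l + 1))),
      Literature.ModelTheory.ExponentialFields.IsSemialgebraic ℚ σ → Bornology.IsBounded σ →
      Literature.ModelTheory.ExponentialFields.IsSemialgebraic ℚ S →
      (∀ i, Literature.NumberTheory.Transcendental.IsSemialgebraicFunOn ℚ S (ξ i)) →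
      (∀ x ∈ S, StrictMono fun i => ξ i x) →
      (∀ j ∈ B, Literature.ModelTheory.ExponentialFields.bandOver S ξ j ⊆ σ) →
      (∀ x ∈ S, {t : ℝ | (Fin.snoc x t : Fin (n + 1) → ℝ) ∈ σ} =
        (⋃ j ∈ G, {ξ j x}) ∪ ⋃ j ∈ B, {t : ℝ | Literature.ModelTheory.ExponentialFields.bandLower ξ j x < t ∧
          (t : EReal) < Literature.ModelTheory.ExponentialFields.bandUpper ξ j x}) →
      ∃ (J : ℕ) (a b : Fin J → (Fin n → ℝ) → ℝ) (R : Fin J → Set (Fin (n + 1) → ℝ)),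
        (∀ j, Literature.NumberTheory.Transcendental.IsSemialgebraicFunOn ℚ S (a j)) ∧
        (∀ j, Literature.NumberTheory.Transcendental.IsSemialgebraicFunOn ℚ S (b j)) ∧
        (∀ j, ∀ x ∈ S, a j x < b j x) ∧
        (∀ j, R j = {z : Fin (n + 1) → ℝ | Fin.init z ∈ S ∧
          z (Fin.last n) ∈ Set.Ioo (a j (Fin.init z)) (b j (Fin.init z))}) ∧
        (∀ j, Literature.ModelTheory.ExponentialFields.IsSemialgebraic ℚ (R j)) ∧
        (∀ j, ∀ x ∈ S, Set.Ioo (a j x) (b j x) ⊆ {s : ℝ | (Fin.snoc x s : Fin (n + 1) → ℝ) ∈ σ}) ∧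
        (∀ j, ∀ x ∈ S, a j x ∈ frontier {s : ℝ | (Fin.snoc x s : Fin (n + 1) → ℝ) ∈ σ} ∧
          b j x ∈ frontier {s : ℝ | (Fin.snoc x s : Fin (n + 1) → ℝ) ∈ σ}) ∧
        (Pairwise fun i j => Disjoint (R i) (R j)) ∧
        MeasureTheory.volume ((σ ∩ {z : Fin (n + 1) → ℝ | Fin.init z ∈ S}) \ ⋃ j, R j) = 0 := by
  classical
  intro n σ S l ξ G B hσ hbdd hS hξ hmono hBσ hfib
  -- empty base: nothing to do
  rcases S.eq_empty_or_nonempty with hSe | ⟨x₀, hx₀⟩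
  · subst hSe
    refine ⟨0, fun j => Fin.elim0 j, fun j => Fin.elim0 j, fun j => Fin.elim0 j, fun j => Fin.elim0 j,
      fun j => Fin.elim0 j, fun j => Fin.elim0 j, fun j => Fin.elim0 j, fun j => Fin.elim0 j,
      fun j => Fin.elim0 j, fun j => Fin.elim0 j, fun j => Fin.elim0 j, ?_⟩
    simp
  -- the sup norm controls the last coordinate
  obtain ⟨C, hC⟩ := isBounded_iff_forall_norm_le.1 hbdd
  have hnorm : ∀ (x : Fin n → ℝ) (t : ℝ), (Fin.snoc x t : Fin (n + 1) → ℝ) ∈ σ → |t| ≤ C := by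
    intro x t h
    have h1 := hC _ h
    have h2 := norm_le_pi_norm (Fin.snoc x t : Fin (n + 1) → ℝ) (Fin.last n)
    rw [Fin.snoc_last, Real.norm_eq_abs] at h2
    exact h2.trans h1
  -- the two unbounded bands are not in `B`
  have h0B : (0 : Fin (l + 1)) ∉ B := by
    intro h0
    obtain ⟨T, hT⟩ : ∃ T : ℝ, ∀ t : ℝ, t < T → ((t : ℝ) : EReal) < bandUpper ξ 0 x₀ := by
      cases l with
      | zero =>
        refine ⟨0, fun t _ => ?_⟩
        rw [show (0 : Fin (0 + 1)) = Fin.last 0 from rfl, bandUpper_last]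
        exact EReal.coe_lt_top _
      | succ l =>
        refine ⟨ξ 0 x₀, fun t ht => ?_⟩
        rw [bandUpper_zero]
        exact EReal.coe_lt_coe_iff.2 ht
    set t : ℝ := min (T - 1) (-(C + 1)) with ht_def
    have hmem : (Fin.snoc x₀ t : Fin (n + 1) → ℝ) ∈ σ := by
      refine hBσ 0 h0 (snoc_mem_bandOver_iff.2 ⟨hx₀, ?_, hT t ?_⟩)
      · rw [bandLower_zero]
        exact EReal.bot_lt_coe _
      · have := min_le_left (T - 1) (-(C + 1))
        linarith
    have h1 := hnorm x₀ t hmem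
    have h2 : t ≤ -(C + 1) := min_le_right _ _
    have h3 : -t ≤ |t| := neg_le_abs t
    linarith
  have hlB : Fin.last l ∉ B := by
    intro hl
    obtain ⟨T, hT⟩ : ∃ T : ℝ, ∀ t : ℝ, T < t → bandLower ξ (Fin.last l) x₀ < ((t : ℝ) : EReal) := by
      cases l with
      | zero =>
        refine ⟨0, fun t _ => ?_⟩
        rw [show Fin.last 0 = (0 : Fin (0 + 1)) from rfl, bandLower_zero]
        exact EReal.bot_lt_coe _
      | succ l =>
        refine ⟨ξ (Fin.last l) x₀, fun t ht => ?_⟩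
        rw [bandLower_last]
        exact EReal.coe_lt_coe_iff.2 ht
    set t : ℝ := max (T + 1) (C + 1) with ht_def
    have hmem : (Fin.snoc x₀ t : Fin (n + 1) → ℝ) ∈ σ := by
      refine hBσ _ hl (snoc_mem_bandOver_iff.2 ⟨hx₀, hT t ?_, ?_⟩)
      · have := le_max_left (T + 1) (C + 1)
        linarith
      · rw [bandUpper_last]
        exact EReal.coe_lt_top _
    have h1 := hnorm x₀ t hmem
    have h2 : C + 1 ≤ t := le_max_right _ _
    have h3 : t ≤ |t| := le_abs_self t
    linarith
  -- the maximal chains of bands of `B` linked through sections of `G`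
  let P : ℕ → Prop := fun k => ∃ j ∈ B, (j : ℕ) = k
  let Q : ℕ → Prop := fun m => ∃ i ∈ G, (i : ℕ) = m
  have hPb : ∀ k, P k → 0 < k ∧ k < l := by
    rintro k ⟨j, hj, rfl⟩
    refine ⟨Nat.pos_of_ne_zero fun h => h0B ?_, lt_of_le_of_ne (Nat.lt_succ_iff.1 j.isLt) fun h => hlB ?_⟩
    · have : j = 0 := Fin.ext h
      rwa [← this]
    · have : j = Fin.last l := Fin.ext (by rw [h, Fin.val_last])
      rwa [← this]
  obtain ⟨J, p, q, hpq, hqL, hPch, hQch, hstart, hend, hcov, hdisj⟩ :=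
    exists_maximal_chains l P Q hPb
  have hpL : ∀ j, p j < l := fun j => (hpq j).trans (hqL j)
  let ip : Fin J → Fin l := fun j => ⟨p j, hpL j⟩
  let iq : Fin J → Fin l := fun j => ⟨q j, hqL j⟩
  -- monotonicity of the sections
  have hlt_iff : ∀ x ∈ S, ∀ i i' : Fin l, ξ i x < ξ i' x ↔ i < i' := fun x hx i i' =>
    (hmono x hx).lt_iff_lt
  have hle_iff : ∀ x ∈ S, ∀ i i' : Fin l, ξ i x ≤ ξ i' x ↔ i ≤ i' := fun x hx i i' =>
    (hmono x hx).le_iff_le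
  -- the fibre of `σ` over `x ∈ S`, in terms of sections of `G` and bands of `B`
  have hF : ∀ x ∈ S, ∀ t : ℝ, (Fin.snoc x t : Fin (n + 1) → ℝ) ∈ σ ↔
      (∃ i ∈ G, t = ξ i x) ∨
        ∃ i i' : Fin l, (i' : ℕ) = i + 1 ∧ i.succ ∈ B ∧ ξ i x < t ∧ t < ξ i' x := by
    intro x hx t
    have ht : (Fin.snoc x t : Fin (n + 1) → ℝ) ∈ σ ↔
        t ∈ {t : ℝ | (Fin.snoc x t : Fin (n + 1) → ℝ) ∈ σ} := Iff.rfl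
    rw [ht, hfib x hx]
    simp only [mem_union, mem_iUnion, mem_singleton_iff, mem_setOf_eq, exists_prop]
    constructor
    · rintro (⟨i, hi, rfl⟩ | ⟨j, hj, hlo, hup⟩)
      · exact Or.inl ⟨i, hi, rfl⟩
      · right
        have hj0 : j ≠ 0 := fun h => h0B (h ▸ hj)
        have hjl : j ≠ Fin.last l := fun h => hlB (h ▸ hj)
        rw [bandLower_of_ne_zero ξ j hj0, EReal.coe_lt_coe_iff] at hlo
        rw [bandUpper_of_ne_last ξ j hjl, EReal.coe_lt_coe_iff] at hup
        refine ⟨j.pred hj0, j.castPred hjl, ?_, ?_, hlo, hup⟩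
        · rw [Fin.val_pred, Fin.coe_castPred]
          have : (j : ℕ) ≠ 0 := fun h => hj0 (Fin.ext h)
          omega
        · rw [Fin.succ_pred]
          exact hj
    · rintro (⟨i, hi, rfl⟩ | ⟨i, i', hii', hB, hlo, hup⟩)
      · exact Or.inl ⟨i, hi, rfl⟩
      · refine Or.inr ⟨i.succ, hB, ?_, ?_⟩
        · rw [bandLower_succ]
          exact EReal.coe_lt_coe_iff.2 hlo
        · have : i.succ = i'.castSucc := Fin.ext (by rw [Fin.val_succ, Fin.val_castSucc, hii'])
          rw [this, bandUpper_castSucc]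
          exact EReal.coe_lt_coe_iff.2 hup
  -- a section value never lies strictly inside a band
  have hsec_band : ∀ x ∈ S, ∀ m i i' : Fin l, (i' : ℕ) = i + 1 →
      ¬ (ξ i x < ξ m x ∧ ξ m x < ξ i' x) := by
    rintro x hx m i i' hii' ⟨h1, h2⟩
    rw [hlt_iff x hx] at h1 h2
    have h1' := Fin.lt_def.1 h1
    have h2' := Fin.lt_def.1 h2
    omega
  -- the fibres of the runs lie in the fibres of `σ`
  have hIoo : ∀ j, ∀ x ∈ S, Ioo (ξ (ip j) x) (ξ (iq j) x) ⊆
      {s : ℝ | (Fin.snoc x s : Fin (n + 1) → ℝ) ∈ σ} := by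
    intro j x hx t ht
    rw [mem_setOf_eq, hF x hx]
    -- the highest section below or at `t`
    let I : Finset (Fin l) := (Finset.univ : Finset (Fin l)).filter fun i : Fin l => ξ i x ≤ t
    have hIp : ip j ∈ I := Finset.mem_filter.2 ⟨Finset.mem_univ _, ht.1.le⟩
    have hIne : I.Nonempty := ⟨_, hIp⟩
    have hi₀I : I.max' hIne ∈ I := Finset.max'_mem _ _
    have hi₀t : ξ (I.max' hIne) x ≤ t := (Finset.mem_filter.1 hi₀I).2
    have hmax : ∀ i : Fin l, ξ i x ≤ t → i ≤ I.max' hIne := fun i hi =>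
      Finset.le_max' I i (Finset.mem_filter.2 ⟨Finset.mem_univ i, hi⟩)
    set i₀ := I.max' hIne with hi₀_def
    have hpi₀ : ip j ≤ i₀ := hmax _ ht.1.le
    have hi₀q : i₀ < iq j := by
      rw [← hlt_iff x hx]
      exact lt_of_le_of_lt hi₀t ht.2
    have hpi₀' := Fin.le_def.1 hpi₀
    have hi₀q' := Fin.lt_def.1 hi₀q
    rcases hi₀t.eq_or_lt with heq | hlt
    · -- `t` is the section `i₀`, strictly between `p` and `q`, hence in `G`
      left
      have hne : ip j ≠ i₀ := by
        intro h
        rw [← h] at heq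
        exact (ne_of_lt ht.1) heq
      have hpi₀'' : (p j : ℕ) < i₀ := lt_of_le_of_ne hpi₀' fun h => hne (Fin.ext h)
      obtain ⟨i, hi, hii₀⟩ := hQch j i₀ hpi₀'' hi₀q'
      have hi' : i = i₀ := Fin.ext hii₀
      exact ⟨i₀, hi' ▸ hi, heq.symm⟩
    · -- `t` lies in the band above the section `i₀`
      right
      have hi₀l : (i₀ : ℕ) + 1 < l := by
        have := (iq j).isLt
        simp only [iq] at this hi₀q'
        omega
      refine ⟨i₀, ⟨i₀ + 1, hi₀l⟩, rfl, ?_, hlt, ?_⟩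
      · obtain ⟨j', hj', hj'v⟩ := hPch j (i₀ + 1) (by simp only [ip] at hpi₀'; omega)
          (by simp only [iq] at hi₀q'; omega)
        have : j' = i₀.succ := Fin.ext (by rw [hj'v, Fin.val_succ])
        exact this ▸ hj'
      · by_contra h
        have h' := hmax ⟨i₀ + 1, hi₀l⟩ (not_lt.mp h)
        have := Fin.le_def.1 h'
        simp at this
  -- sections outside `G` and bands outside `B` miss the fibre of `σ`
  have hnotmem : ∀ x ∈ S, ∀ m : Fin l, m ∉ G →
      ξ m x ∉ {s : ℝ | (Fin.snoc x s : Fin (n + 1) → ℝ) ∈ σ} := by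
    intro x hx m hm hmem
    rw [mem_setOf_eq, hF x hx] at hmem
    rcases hmem with ⟨i, hi, heq⟩ | ⟨i, i', hii', -, h1, h2⟩
    · have : m = i := (hmono x hx).injective heq
      exact hm (this ▸ hi)
    · exact hsec_band x hx m i i' hii' ⟨h1, h2⟩
  have hband_out : ∀ x ∈ S, ∀ i i' : Fin l, (i' : ℕ) = i + 1 → i.succ ∉ B →
      Ioo (ξ i x) (ξ i' x) ⊆ {s : ℝ | (Fin.snoc x s : Fin (n + 1) → ℝ) ∈ σ}ᶜ := by
    intro x hx i i' hii' hiB t ht hmem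
    rw [mem_setOf_eq, hF x hx] at hmem
    rcases hmem with ⟨m, -, rfl⟩ | ⟨k, k', hkk', hkB, h1, h2⟩
    · exact hsec_band x hx m i i' hii' ht
    · have h3 := Fin.lt_def.1 ((hlt_iff x hx _ _).1 (ht.1.trans h2))
      have h4 := Fin.lt_def.1 ((hlt_iff x hx _ _).1 (h1.trans ht.2))
      have : k = i := Fin.ext (by omega)
      subst this
      exact hiB hkB
  have hbelow : ∀ x ∈ S, ∀ t : ℝ, (∀ i : Fin l, t < ξ i x) →
      t ∉ {s : ℝ | (Fin.snoc x s : Fin (n + 1) → ℝ) ∈ σ} := by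
    intro x hx t ht hmem
    rw [mem_setOf_eq, hF x hx] at hmem
    rcases hmem with ⟨m, -, rfl⟩ | ⟨k, -, -, -, h1, -⟩
    · exact lt_irrefl _ (ht m)
    · exact lt_asymm h1 (ht k)
  have habove : ∀ x ∈ S, ∀ t : ℝ, (∀ i : Fin l, ξ i x < t) →
      t ∉ {s : ℝ | (Fin.snoc x s : Fin (n + 1) → ℝ) ∈ σ} := by
    intro x hx t ht hmem
    rw [mem_setOf_eq, hF x hx] at hmem
    rcases hmem with ⟨m, -, rfl⟩ | ⟨-, k', -, -, -, h2⟩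
    · exact lt_irrefl _ (ht m)
    · exact lt_asymm h2 (ht k')
  -- the end points of the runs are frontier points of the fibres
  have hab : ∀ j, ∀ x ∈ S, ξ (ip j) x < ξ (iq j) x := fun j x hx =>
    (hlt_iff x hx _ _).2 (Fin.mk_lt_mk.2 (hpq j))
  have hfront : ∀ j, ∀ x ∈ S,
      ξ (ip j) x ∈ frontier {s : ℝ | (Fin.snoc x s : Fin (n + 1) → ℝ) ∈ σ} ∧
        ξ (iq j) x ∈ frontier {s : ℝ | (Fin.snoc x s : Fin (n + 1) → ℝ) ∈ σ} := by
    intro j x hx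
    constructor
    · refine mem_frontier_left_of_Ioo_subset (hab j x hx) (hIoo j x hx) ?_
      by_cases hQ : ip j ∈ G
      · right
        have hnotP : ¬ P (p j) := fun hP' => hstart j ⟨hP', ⟨ip j, hQ, rfl⟩⟩
        by_cases hp0 : p j = 0
        · refine ⟨ξ (ip j) x - 1, by linarith, fun t ht => hbelow x hx t fun i => ?_⟩
          calc t < ξ (ip j) x := ht.2
            _ ≤ ξ i x := (hle_iff x hx _ _).2 (Fin.le_def.2 (by simp only [ip]; omega))
        · have hp1 : p j - 1 < l := by have := hpL j; omega
          refine ⟨ξ ⟨p j - 1, hp1⟩ x, (hlt_iff x hx _ _).2 (Fin.mk_lt_mk.2 (by omega)),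
            hband_out x hx ⟨p j - 1, hp1⟩ (ip j) (by simp only [ip]; omega) fun hB' =>
              hnotP ⟨_, hB', ?_⟩⟩
          show p j - 1 + 1 = p j
          omega
      · exact Or.inl (hnotmem x hx _ hQ)
    · refine mem_frontier_right_of_Ioo_subset (hab j x hx) (hIoo j x hx) ?_
      by_cases hQ : iq j ∈ G
      · right
        have hnotP : ¬ P (q j + 1) := fun hP' => hend j ⟨⟨iq j, hQ, rfl⟩, hP'⟩
        by_cases hql : q j + 1 < l
        · refine ⟨ξ ⟨q j + 1, hql⟩ x, (hlt_iff x hx _ _).2 (Fin.mk_lt_mk.2 (by omega)),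
            hband_out x hx (iq j) ⟨q j + 1, hql⟩ rfl fun hB' => hnotP ⟨_, hB', ?_⟩⟩
          rw [Fin.val_succ]
        · refine ⟨ξ (iq j) x + 1, by linarith, fun t ht => habove x hx t fun i => ?_⟩
          calc ξ i x ≤ ξ (iq j) x :=
                (hle_iff x hx _ _).2 (Fin.le_def.2 (by have := i.isLt; simp only [iq]; omega))
            _ < t := ht.1
      · exact Or.inl (hnotmem x hx _ hQ)
  -- the runs
  refine ⟨J, fun j => ξ (ip j), fun j => ξ (iq j), fun j => {z : Fin (n + 1) → ℝ | Fin.init z ∈ S ∧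
      z (Fin.last n) ∈ Ioo (ξ (ip j) (Fin.init z)) (ξ (iq j) (Fin.init z))}, fun j => hξ _,
    fun j => hξ _, hab, fun j => rfl, fun j => isSemialgebraic_openBand (hξ _) (hξ _), hIoo, hfront,
    ?_, ?_⟩
  · -- distinct runs are disjoint
    intro i j hij
    rw [Set.disjoint_left]
    rintro z ⟨hzS, h1, h2⟩ ⟨-, h3, h4⟩
    rcases hdisj i j hij with h | h
    · have := (hle_iff _ hzS (iq i) (ip j)).2 (Fin.mk_le_mk.2 h)
      linarith
    · have := (hle_iff _ hzS (iq j) (ip i)).2 (Fin.mk_le_mk.2 h)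
      linarith
  · -- the remainder over `S` lies in the graphs of the sections
    have hrem : (σ ∩ {z : Fin (n + 1) → ℝ | Fin.init z ∈ S}) \
        (⋃ j, {z : Fin (n + 1) → ℝ | Fin.init z ∈ S ∧
          z (Fin.last n) ∈ Ioo (ξ (ip j) (Fin.init z)) (ξ (iq j) (Fin.init z))}) ⊆
        ⋃ i : Fin l, {z : Fin (n + 1) → ℝ | Fin.init z ∈ S ∧ z (Fin.last n) = ξ i (Fin.init z)} := by
      rintro z ⟨⟨hzσ, hzS⟩, hz⟩
      rw [mem_setOf_eq] at hzS
      have hzσ' : (Fin.snoc (Fin.init z) (z (Fin.last n)) : Fin (n + 1) → ℝ) ∈ σ := by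
        rwa [Fin.snoc_init_self]
      rw [hF _ hzS] at hzσ'
      rcases hzσ' with ⟨i, -, hi⟩ | ⟨i, i', hii', hiB, h1, h2⟩
      · exact mem_iUnion.2 ⟨i, hzS, hi⟩
      · exfalso
        obtain ⟨j, hpj, hjq⟩ := hcov (i + 1) ⟨i.succ, hiB, by rw [Fin.val_succ]⟩
        refine hz (mem_iUnion.2 ⟨j, hzS, ?_, ?_⟩)
        · calc ξ (ip j) (Fin.init z) ≤ ξ i (Fin.init z) :=
                (hle_iff _ hzS _ _).2 (Fin.le_def.2 (by simp only [ip]; omega))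
            _ < z (Fin.last n) := h1
        · calc z (Fin.last n) < ξ i' (Fin.init z) := h2
            _ ≤ ξ (iq j) (Fin.init z) :=
                (hle_iff _ hzS _ _).2 (Fin.le_def.2 (by simp only [iq]; omega))
    exact measure_mono_null hrem
      (measure_iUnion_null_iff.2 fun i => KZ.volume_graph_eq_zero (hξ i))

/-! ### Flattening over the cells, and the theorem -/

/-- **Flattening** (registered stub `stub_assembleRuns` of the birth skeleton of piece
`SemialgebraicFibreRuns`, verbatim): run families over the cells of a finite partition of `ℝⁿ` into
`ℚ`-semialgebraic sets combine into one run family for `σ` (disjoint cells have disjoint cylinders; the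
remainders add up to a null set). [folklore] -/
theorem assembleRuns :
    ∀ (n : ℕ) (σ : Set (Fin (n + 1) → ℝ)) (𝒮 : Finset (Set (Fin n → ℝ))),
      Setoid.IsPartition (𝒮 : Set (Set (Fin n → ℝ))) →
      (∀ S ∈ 𝒮, Literature.ModelTheory.ExponentialFields.IsSemialgebraic ℚ S) →
      (∀ S ∈ 𝒮, ∃ (J : ℕ) (a b : Fin J → (Fin n → ℝ) → ℝ) (R : Fin J → Set (Fin (n + 1) → ℝ)),
        (∀ j, Literature.NumberTheory.Transcendental.IsSemialgebraicFunOn ℚ S (a j)) ∧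
        (∀ j, Literature.NumberTheory.Transcendental.IsSemialgebraicFunOn ℚ S (b j)) ∧
        (∀ j, ∀ x ∈ S, a j x < b j x) ∧
        (∀ j, R j = {z : Fin (n + 1) → ℝ | Fin.init z ∈ S ∧
          z (Fin.last n) ∈ Set.Ioo (a j (Fin.init z)) (b j (Fin.init z))}) ∧
        (∀ j, Literature.ModelTheory.ExponentialFields.IsSemialgebraic ℚ (R j)) ∧
        (∀ j, ∀ x ∈ S, Set.Ioo (a j x) (b j x) ⊆ {s : ℝ | (Fin.snoc x s : Fin (n + 1) → ℝ) ∈ σ}) ∧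
        (∀ j, ∀ x ∈ S, a j x ∈ frontier {s : ℝ | (Fin.snoc x s : Fin (n + 1) → ℝ) ∈ σ} ∧
          b j x ∈ frontier {s : ℝ | (Fin.snoc x s : Fin (n + 1) → ℝ) ∈ σ}) ∧
        (Pairwise fun i j => Disjoint (R i) (R j)) ∧
        MeasureTheory.volume ((σ ∩ {z : Fin (n + 1) → ℝ | Fin.init z ∈ S}) \ ⋃ j, R j) = 0) →
      ∃ (J : ℕ) (S : Fin J → Set (Fin n → ℝ)) (a b : Fin J → (Fin n → ℝ) → ℝ) (R : Fin J → Set (Fin (n + 1) → ℝ)),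
        (∀ j, Literature.ModelTheory.ExponentialFields.IsSemialgebraic ℚ (S j)) ∧
        (∀ j, Literature.NumberTheory.Transcendental.IsSemialgebraicFunOn ℚ (S j) (a j)) ∧
        (∀ j, Literature.NumberTheory.Transcendental.IsSemialgebraicFunOn ℚ (S j) (b j)) ∧
        (∀ j, ∀ x ∈ S j, a j x < b j x) ∧
        (∀ j, R j = {z : Fin (n + 1) → ℝ | Fin.init z ∈ S j ∧
          z (Fin.last n) ∈ Set.Ioo (a j (Fin.init z)) (b j (Fin.init z))}) ∧
        (∀ j, Literature.ModelTheory.ExponentialFields.IsSemialgebraic ℚ (R j)) ∧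
        (∀ j, ∀ x ∈ S j, Set.Ioo (a j x) (b j x) ⊆ {s : ℝ | (Fin.snoc x s : Fin (n + 1) → ℝ) ∈ σ}) ∧
        (∀ j, ∀ x ∈ S j, a j x ∈ frontier {s : ℝ | (Fin.snoc x s : Fin (n + 1) → ℝ) ∈ σ} ∧
          b j x ∈ frontier {s : ℝ | (Fin.snoc x s : Fin (n + 1) → ℝ) ∈ σ}) ∧
        (Pairwise fun i j => Disjoint (R i) (R j)) ∧
        MeasureTheory.volume (σ \ ⋃ j, R j) = 0 := by
  classical
  intro n σ 𝒮 hpart hsa hcell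
  choose J a b R hA hB hab hR hRsa hIoo hfr hdisj hnull using hcell
  -- one index type for all the runs
  let ι := Σ s : {S // S ∈ 𝒮}, Fin (J s.1 s.2)
  let F : ι → Set (Fin (n + 1) → ℝ) := fun u => R u.1.1 u.1.2 u.2
  let e : Fin (Fintype.card ι) ≃ ι := (Fintype.equivFin ι).symm
  -- runs with distinct indices are disjoint
  have hcyl : ∀ u : ι, F u ⊆ {z : Fin (n + 1) → ℝ | Fin.init z ∈ (u.1 : Set (Fin n → ℝ))} := by
    rintro ⟨⟨S, hS⟩, k⟩ z hz
    simp only [F] at hz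
    rw [hR S hS k] at hz
    exact hz.1
  have key : ∀ u v : ι, u ≠ v → Disjoint (F u) (F v) := by
    rintro ⟨⟨S, hS⟩, k⟩ ⟨⟨S', hS'⟩, k'⟩ huv
    by_cases hSS' : S = S'
    · subst hSS'
      have hkk' : k ≠ k' := fun h => huv (by subst h; rfl)
      exact hdisj S hS hkk'
    · have hcells : Disjoint S S' :=
        hpart.pairwiseDisjoint (Finset.mem_coe.2 hS) (Finset.mem_coe.2 hS') hSS'
      rw [Set.disjoint_left]
      intro z hz hz'
      have h1 := hcyl _ hz
      have h2 := hcyl _ hz'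
      simp only [mem_setOf_eq] at h1 h2
      exact Set.disjoint_left.1 hcells h1 h2
  refine ⟨Fintype.card ι, fun i => (e i).1.1, fun i => a _ (e i).1.2 (e i).2,
    fun i => b _ (e i).1.2 (e i).2, fun i => F (e i), fun i => hsa _ (e i).1.2,
    fun i => hA _ (e i).1.2 (e i).2, fun i => hB _ (e i).1.2 (e i).2, fun i => hab _ (e i).1.2 (e i).2,
    fun i => hR _ (e i).1.2 (e i).2, fun i => hRsa _ (e i).1.2 (e i).2,
    fun i => hIoo _ (e i).1.2 (e i).2, fun i => hfr _ (e i).1.2 (e i).2,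
    fun i j hij => key _ _ fun h => hij (e.injective h), ?_⟩
  -- the remainder is the union of the remainders over the cells
  have hU : (⋃ i, F (e i)) = ⋃ u, F u := e.surjective.iUnion_comp F
  have hrem : σ \ (⋃ u, F u) ⊆ ⋃ s : {S // S ∈ 𝒮},
      ((σ ∩ {z : Fin (n + 1) → ℝ | Fin.init z ∈ (s.1 : Set (Fin n → ℝ))}) \ ⋃ k, R s.1 s.2 k) := by
    rintro z ⟨hzσ, hz⟩
    have hcov : (Fin.init z : Fin n → ℝ) ∈ ⋃₀ (𝒮 : Set (Set (Fin n → ℝ))) := by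
      rw [hpart.sUnion_eq_univ]
      exact mem_univ _
    obtain ⟨S, hS, hzS⟩ := mem_sUnion.1 hcov
    refine mem_iUnion.2 ⟨⟨S, Finset.mem_coe.1 hS⟩, ⟨hzσ, hzS⟩, fun hz' => hz ?_⟩
    obtain ⟨k, hk⟩ := mem_iUnion.1 hz'
    exact mem_iUnion.2 ⟨⟨⟨S, Finset.mem_coe.1 hS⟩, k⟩, hk⟩
  show volume (σ \ ⋃ i, F (e i)) = 0
  rw [hU]
  exact measure_mono_null hrem (measure_iUnion_null_iff.2 fun s => hnull s.1 s.2)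

/-- **`SemialgebraicFibreRuns`** (piece X₁ of the typed decomposition of `KZStokes`; the statement is,
verbatim, the registered stub `stub_semialgebraicFibreRuns` of line `runs_and_bands` of crux
stmt-KontsevichZagierPeriods-3012): every bounded `ℚ`-semialgebraic `σ ⊆ ℝⁿ⁺¹` is, off a null set, a
finite disjoint union of open run bands over `ℚ`-semialgebraic bases with `ℚ`-semialgebraic edges, with
fibres inside `σ_x` and end points on `frontier σ_x` — the adapted cylindrical decomposition (PROVED in
the tree) feeds `cellRuns` cell by cell and `assembleRuns` flattens. [Basu–Pollack–Roy 2006, Cor. 5.7] -/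
theorem semialgebraicFibreRuns :
    ∀ (n : ℕ) (σ : Set (Fin (n + 1) → ℝ)), Literature.ModelTheory.ExponentialFields.IsSemialgebraic ℚ σ → Bornology.IsBounded σ → ∃ (J : ℕ) (S : Fin J → Set (Fin n → ℝ)) (a b : Fin J → (Fin n → ℝ) → ℝ) (R : Fin J → Set (Fin (n + 1) → ℝ)), (∀ j, Literature.ModelTheory.ExponentialFields.IsSemialgebraic ℚ (S j)) ∧ (∀ j, Literature.NumberTheory.Transcendental.IsSemialgebraicFunOn ℚ (S j) (a j)) ∧ (∀ j, Literature.NumberTheory.Transcendental.IsSemialgebraicFunOn ℚ (S j) (b j)) ∧ (∀ j, ∀ x ∈ S j, a j x < b j x) ∧ (∀ j, R j = {z : Fin (n + 1) → ℝ | Fin.init z ∈ S j ∧ z (Fin.last n) ∈ Set.Ioo (a j (Fin.init z)) (b j (Fin.init z))}) ∧ (∀ j, Literature.ModelTheory.ExponentialFields.IsSemialgebraic ℚ (R j)) ∧ (∀ j, ∀ x ∈ S j, Set.Ioo (a j x) (b j x) ⊆ {s : ℝ | (Fin.snoc x s : Fin (n + 1) → ℝ) ∈ σ}) ∧ (∀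 j, ∀ x ∈ S j, a j x ∈ frontier {s : ℝ | (Fin.snoc x s : Fin (n + 1) → ℝ) ∈ σ} ∧ b j x ∈ frontier {s : ℝ | (Fin.snoc x s : Fin (n + 1) → ℝ) ∈ σ}) ∧ (Pairwise fun i j => Disjoint (R i) (R j)) ∧ MeasureTheory.volume (σ \ ⋃ j, R j) = 0 := by
  intro n σ hσ hbdd
  obtain ⟨𝒮, l, ξ, h𝒮, -, hsa, hmono, -, hGB⟩ :=
    IsSemialgebraic.exists_cylindricalDecomposition.exists_fibre_eq
      (IsSemialgebraic.exists_cylindricalDecomposition_holds (k := ℚ)) hσ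
  refine assembleRuns n σ 𝒮 h𝒮.isPartition h𝒮.isSemialgebraic fun S hS => ?_
  obtain ⟨G, B, -, hB, hfib⟩ := hGB S hS
  exact cellRuns n σ S (l S) (ξ S) G B hσ hbdd (h𝒮.isSemialgebraic S hS) (hsa S hS) (hmono S hS) hB hfib

/-! ### Piece X₂: Newton–Leibniz on one open band -/

/-- **`KZStokesBand`** (piece X₂ of the typed decomposition of `KZStokes`; the statement is, verbatim,
the registered stub `stub_kzStokesBand` of line `runs_and_bands` of crux stmt-KontsevichZagierPeriods-3012):
Newton–Leibniz on one open band over a `ℚ`-semialgebraic base with a primitive vanishing at both ends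
puts `[r]` in `KZ.relations`. [Kontsevich–Zagier 2001, §1.2, rules 1) and 3)] -/
theorem kzStokesBand :
    ∀ (n : ℕ) (S : Set (Fin n → ℝ)) (a b : (Fin n → ℝ) → ℝ) (r : Literature.NumberTheory.Transcendental.KZ.IntegralRep (n + 1)) (H : (Fin (n + 1) → ℝ) → ℝ), Literature.ModelTheory.ExponentialFields.IsSemialgebraic ℚ S → Literature.NumberTheory.Transcendental.IsSemialgebraicFunOn ℚ S a → Literature.NumberTheory.Transcendental.IsSemialgebraicFunOn ℚ S b → (∀ x ∈ S, a x < b x) → r.domain = {z : Fin (n + 1) → ℝ | Fin.init z ∈ S ∧ z (Fin.last n) ∈ Set.Ioo (a (Fin.init z)) (b (Fin.init z))} → Literature.NumberTheory.Transcendental.IsSemialgebraicFunOn ℚ {z : Fin (n + 1) → ℝ | Fin.init z ∈ S ∧ z (Fin.last n) ∈ Set.Icc (a (Fin.init z)) (b (Fin.init z))} H → (∀ x ∈ S, ContinuousOn (fun s : ℝ => H (Fin.snoc x s)) (Set.Icc (a x) (b x)) ∧ H (Fin.snoc x (a x)) = 0 ∧ H (Fin.snoc x (b x)) = 0 ∧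 ∀ t ∈ Set.Ioo (a x) (b x), HasDerivAt (fun s : ℝ => H (Fin.snoc x s)) (r.integrand (Fin.snoc x t)) t) → Literature.NumberTheory.Transcendental.KZ.of r ∈ Literature.NumberTheory.Transcendental.KZ.relations := by
  intro n S a b r H hS ha hb hab hdom hH hfib
  -- the closed band
  set Bd : Set (Fin (n + 1) → ℝ) := KZlog.band S a b with hBd_def
  have hBd : IsSemialgebraic ℚ Bd := KZlog.isSemialgebraic_band ha hb
  have hOB : r.domain ⊆ Bd := by
    intro z hz
    rw [hdom] at hz
    exact ⟨hz.1, hz.2.1.le, hz.2.2.le⟩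
  have hHB : IsSemialgebraicFunOn ℚ Bd H := by
    have hEq : {z : Fin (n + 1) → ℝ | Fin.init z ∈ S ∧
        z (Fin.last n) ∈ Icc (a (Fin.init z)) (b (Fin.init z))} = Bd := by
      ext z
      simp only [mem_setOf_eq, mem_Icc, hBd_def, KZlog.mem_band]
    rw [← hEq]
    exact hH
  -- the band integrand: `r.integrand` extended by zero off the open band
  set g : (Fin (n + 1) → ℝ) → ℝ := r.domain.indicator r.integrand with hg_def
  have hgS : IsSemialgebraicFunOn ℚ Bd g := by
    have h1 : IsSemialgebraicFunOn ℚ r.domain g :=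
      r.isSemialgebraicFunOn_integrand.congr fun z hz => (indicator_of_mem hz _).symm
    have h2 : IsSemialgebraicFunOn ℚ (Bd \ r.domain) g :=
      (isSemialgebraicFunOn_ratCast (hBd.diff r.isSemialgebraic_domain) 0).congr fun z hz => by
        simp [hg_def, indicator_of_notMem hz.2]
    have h := h1.union h2 (fun _ _ => rfl) (fun _ _ => rfl)
    rwa [Set.union_sdiff_cancel hOB] at h
  have hmeas : MeasurableSet r.domain := KZ.IntegralRep.measurableSet_domain_holds r
  have hgI : IntegrableOn g Bd := ((integrable_indicator_iff hmeas).mpr r.integrableOn).integrableOn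
  let R : KZ.IntegralRep (n + 1) := ⟨Bd, g, hBd, hgS, hgI⟩
  -- the base of the move: the zero representation on `S`
  obtain ⟨Z, hZd, hZi⟩ := KZ.exists_zeroRep hS
  have hZ : KZ.of Z ∈ KZ.relations := KZ.of_mem_relations_of_eqOn_zero Z (by simp [hZi, EqOn])
  -- fibre points of the open band
  have hsnoc : ∀ x ∈ S, ∀ t ∈ Ioo (a x) (b x), (Fin.snoc x t : Fin (n + 1) → ℝ) ∈ r.domain := by
    intro x hx t ht
    rw [hdom]
    simp only [mem_setOf_eq, Fin.init_snoc, Fin.snoc_last]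
    exact ⟨hx, ht⟩
  -- ONE Newton–Leibniz move: `[R] − [Z]`
  have hNL : KZ.of R - KZ.of Z ∈ KZ.relations := by
    refine KZ.newtonLeibnizRel_subset_relations ⟨n, R, Z, a, b, H, hHB, by rw [hZd]; exact ha,
      by rw [hZd]; exact hb, fun x hx => ?_, by rw [hZd]; rfl, fun x hx => ?_, fun x hx t ht => ?_,
      fun x hx => ?_, rfl⟩
    · rw [hZd] at hx
      exact (hab x hx).le
    · rw [hZd] at hx
      exact (hfib x hx).1
    · rw [hZd] at hx
      have h := (hfib x hx).2.2.2 t ht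
      show HasDerivAt (fun s : ℝ => H (Fin.snoc x s)) (g (Fin.snoc x t)) t
      rw [hg_def, indicator_of_mem (hsnoc x hx t ht)]
      exact h
    · rw [hZd] at hx
      rw [hZi, (hfib x hx).2.1, (hfib x hx).2.2.1]
      simp
  have hR : KZ.of R ∈ KZ.relations := by
    simpa using KZ.relations.add_mem hNL hZ
  -- the two edge graphs are null
  have hnull : volume (R.domain \ r.domain) = 0 := by
    have hcov : R.domain \ r.domain ⊆
        {z : Fin (n + 1) → ℝ | Fin.init z ∈ S ∧ z (Fin.last n) = a (Fin.init z)} ∪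
          {z : Fin (n + 1) → ℝ | Fin.init z ∈ S ∧ z (Fin.last n) = b (Fin.init z)} := by
      rintro z ⟨⟨hzS, h1, h2⟩, hz⟩
      rw [hdom] at hz
      simp only [mem_setOf_eq, mem_Ioo, not_and] at hz
      rcases h1.eq_or_lt with h | h
      · exact Or.inl ⟨hzS, h.symm⟩
      · refine Or.inr ⟨hzS, le_antisymm h2 (not_lt.mp fun h' => hz hzS h h')⟩
    exact measure_mono_null hcov
      (measure_union_null (KZ.volume_graph_eq_zero ha) (KZ.volume_graph_eq_zero hb))
  -- `[R] − [R|open band]` and `[R|open band] − [r]` are relations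
  have h2 : KZ.of R - KZ.of (R.restrict r.domain r.isSemialgebraic_domain hOB) ∈ KZ.relations :=
    R.of_sub_of_restrict_mem_relations r.isSemialgebraic_domain hOB hnull
  have h3 : KZ.of (R.restrict r.domain r.isSemialgebraic_domain hOB) - KZ.of r ∈ KZ.relations :=
    KZ.of_sub_of_mem_relations_of_eqOn rfl fun z hz => indicator_of_mem hz _
  have heq : KZ.of r = KZ.of R - (KZ.of R - KZ.of (R.restrict r.domain r.isSemialgebraic_domain hOB)) -
      (KZ.of (R.restrict r.domain r.isSemialgebraic_domain hOB) - KZ.of r) := by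
    abel
  rw [heq]
  exact KZ.relations.sub_mem (KZ.relations.sub_mem hR h2) h3

/-! ### The glue and the crux -/

/-- A point `(x, t)` whose last coordinate lies in the closure of the vertical fibre
`σ_x = {s | (x, s) ∈ σ}` lies in the closure of `σ` (continuity of `s ↦ (x, s)`). [folklore] -/
theorem snoc_mem_closure_of_mem_closure_fibre {n : ℕ} {σ : Set (Fin (n + 1) → ℝ)}
    {x : Fin n → ℝ} {t : ℝ} (ht : t ∈ closure {s : ℝ | (Fin.snoc x s : Fin (n + 1) → ℝ) ∈ σ}) :
    (Fin.snoc x t : Fin (n + 1) → ℝ) ∈ closure σ := by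
  have hc : Continuous fun s : ℝ => (Fin.snoc x s : Fin (n + 1) → ℝ) :=
    Continuous.finSnoc (A := fun _ : Fin (n + 1) => ℝ) continuous_const continuous_id
  exact hc.closure_preimage_subset σ ht

/-- If the open interval `(a, b)` (`a < b`) lies in the vertical fibre `σ_x`, then the closed
interval `[a, b]` lies in its closure. [folklore] -/
theorem Icc_subset_closure_fibre {n : ℕ} {σ : Set (Fin (n + 1) → ℝ)} {x : Fin n → ℝ} {a b : ℝ}
    (hab : a < b) (hsub : Ioo a b ⊆ {s : ℝ | (Fin.snoc x s : Fin (n + 1) → ℝ) ∈ σ}) :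
    Icc a b ⊆ closure {s : ℝ | (Fin.snoc x s : Fin (n + 1) → ℝ) ∈ σ} := by
  rw [← closure_Ioo hab.ne]
  exact closure_mono hsub

/-- The closed band `{(x, t) | x ∈ S, a x ≤ t ≤ b x}` over a `ℚ`-semialgebraic base with
`ℚ`-semialgebraic edges is `ℚ`-semialgebraic (`KZlog.isSemialgebraic_band`, fibres written with
`Set.Icc`). [folklore] -/
theorem isSemialgebraic_closedBand {n : ℕ} {S : Set (Fin n → ℝ)} {a b : (Fin n → ℝ) → ℝ}
    (ha : IsSemialgebraicFunOn ℚ S a) (hb : IsSemialgebraicFunOn ℚ S b) :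
    IsSemialgebraic ℚ {z : Fin (n + 1) → ℝ | Fin.init z ∈ S ∧
      z (Fin.last n) ∈ Icc (a (Fin.init z)) (b (Fin.init z))} := by
  have h := KZlog.isSemialgebraic_band ha hb
  have hEq : {z : Fin (n + 1) → ℝ | Fin.init z ∈ S ∧
      z (Fin.last n) ∈ Icc (a (Fin.init z)) (b (Fin.init z))} = KZlog.band S a b := by
    ext z
    simp only [mem_setOf_eq, mem_Icc, KZlog.mem_band]
  rw [hEq]
  exact h

/-- **Glue of the typed decomposition of `KZStokes`** (crux stmt-KontsevichZagierPeriods-3012,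
route `GaussManinCertificates`): the fibre-run decomposition of bounded `ℚ`-semialgebraic sets
(`SemialgebraicFibreRuns`, first hypothesis, verbatim) and Newton–Leibniz on one open band with
vanishing boundary values (`KZStokesBand`, second hypothesis, verbatim) imply `KZStokes`: cut `[r]`
along the runs by iterated domain additivity (the remainder is null), and on each run apply the band
move with the primitive `H` of `KZStokes`, whose fibrewise hypotheses transport to the run because the
closed run band lies in `closure σ`, its end points are frontier points of the fibre of `σ`, and its
open fibre lies in the interior of the fibre of `σ`.
[Kontsevich–Zagier 2001, §1.2, rules 1) and 3); Basu–Pollack–Roy 2006, Cor. 5.7] -/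
theorem KZStokes_of_subs
    (hA : ∀ (n : ℕ) (σ : Set (Fin (n + 1) → ℝ)),
      Literature.ModelTheory.ExponentialFields.IsSemialgebraic ℚ σ → Bornology.IsBounded σ →
      ∃ (J : ℕ) (S : Fin J → Set (Fin n → ℝ)) (a b : Fin J → (Fin n → ℝ) → ℝ)
        (R : Fin J → Set (Fin (n + 1) → ℝ)),
        (∀ j, Literature.ModelTheory.ExponentialFields.IsSemialgebraic ℚ (S j)) ∧
        (∀ j, Literature.NumberTheory.Transcendental.IsSemialgebraicFunOn ℚ (S j) (a j)) ∧
        (∀ j, Literature.NumberTheory.Transcendental.IsSemialgebraicFunOn ℚ (S j) (b j)) ∧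
        (∀ j, ∀ x ∈ S j, a j x < b j x) ∧
        (∀ j, R j = {z : Fin (n + 1) → ℝ | Fin.init z ∈ S j ∧
          z (Fin.last n) ∈ Set.Ioo (a j (Fin.init z)) (b j (Fin.init z))}) ∧
        (∀ j, Literature.ModelTheory.ExponentialFields.IsSemialgebraic ℚ (R j)) ∧
        (∀ j, ∀ x ∈ S j, Set.Ioo (a j x) (b j x) ⊆
          {s : ℝ | (Fin.snoc x s : Fin (n + 1) → ℝ) ∈ σ}) ∧
        (∀ j, ∀ x ∈ S j, a j x ∈ frontier {s : ℝ | (Fin.snoc x s : Fin (n + 1) → ℝ) ∈ σ} ∧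
          b j x ∈ frontier {s : ℝ | (Fin.snoc x s : Fin (n + 1) → ℝ) ∈ σ}) ∧
        (Pairwise fun i j => Disjoint (R i) (R j)) ∧
        MeasureTheory.volume (σ \ ⋃ j, R j) = 0)
    (hB : ∀ (n : ℕ) (S : Set (Fin n → ℝ)) (a b : (Fin n → ℝ) → ℝ)
        (r : Literature.NumberTheory.Transcendental.KZ.IntegralRep (n + 1)) (H : (Fin (n + 1) → ℝ) → ℝ),
      Literature.ModelTheory.ExponentialFields.IsSemialgebraic ℚ S →
      Literature.NumberTheory.Transcendental.IsSemialgebraicFunOn ℚ S a →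
      Literature.NumberTheory.Transcendental.IsSemialgebraicFunOn ℚ S b →
      (∀ x ∈ S, a x < b x) →
      r.domain = {z : Fin (n + 1) → ℝ | Fin.init z ∈ S ∧
        z (Fin.last n) ∈ Set.Ioo (a (Fin.init z)) (b (Fin.init z))} →
      Literature.NumberTheory.Transcendental.IsSemialgebraicFunOn ℚ {z : Fin (n + 1) → ℝ | Fin.init z ∈ S ∧
        z (Fin.last n) ∈ Set.Icc (a (Fin.init z)) (b (Fin.init z))} H →
      (∀ x ∈ S, ContinuousOn (fun s : ℝ => H (Fin.snoc x s)) (Set.Icc (a x) (b x)) ∧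
        H (Fin.snoc x (a x)) = 0 ∧ H (Fin.snoc x (b x)) = 0 ∧
        ∀ t ∈ Set.Ioo (a x) (b x),
          HasDerivAt (fun s : ℝ => H (Fin.snoc x s)) (r.integrand (Fin.snoc x t)) t) →
      Literature.NumberTheory.Transcendental.KZ.of r ∈ Literature.NumberTheory.Transcendental.KZ.relations) :
    Summit.KontsevichZagierPeriods.KontsevichZagierPeriods.Theses.GaussManinCertificates.KZStokes := by
  intro n r H hbdd hH hcont hfr hder
  obtain ⟨J, S, a, b, R, hS, ha, hb, hab, hR, hRsa, hsub, hfrab, hdisj, hnull⟩ :=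
    hA n r.domain r.isSemialgebraic_domain hbdd
  -- fibrewise membership in a run
  have hmemR : ∀ (j : Fin J) (x : Fin n → ℝ) (t : ℝ), (Fin.snoc x t : Fin (n + 1) → ℝ) ∈ R j ↔
      x ∈ S j ∧ t ∈ Ioo (a j x) (b j x) := fun j x t => by
    rw [hR j]
    simp only [mem_setOf_eq, Fin.init_snoc, Fin.snoc_last]
  -- the runs lie in `σ = r.domain`
  have hRσ : ∀ j, R j ⊆ r.domain := fun j z hz => by
    have hz' : (Fin.snoc (Fin.init z) (z (Fin.last n)) : Fin (n + 1) → ℝ) ∈ R j := by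
      rwa [Fin.snoc_init_self]
    obtain ⟨hx, ht⟩ := (hmemR j _ _).1 hz'
    have h := hsub j _ hx ht
    rwa [mem_setOf_eq, Fin.snoc_init_self] at h
  -- the representations `[R_j, r.integrand]`
  set ρ : Fin J → KZ.IntegralRep (n + 1) := fun j => r.restrict (R j) (hRsa j) (hRσ j) with hρ_def
  have hρd : ∀ j, (ρ j).domain = R j := fun j => rfl
  -- iterated domain additivity over the almost-partition of `σ` by the runs
  have hsum : KZ.of r - ∑ j ∈ (Finset.univ : Finset (Fin J)), KZ.of (ρ j) ∈ KZ.relations := by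
    refine KZ.of_sub_sum_of_mem_relations Finset.univ r ρ (fun j _ => ?_)
      (fun j _ => fun z _ => rfl) ?_ ?_
    · rw [hρd, sdiff_eq_empty.mpr (hRσ j), measure_empty]
    · have h1 : (⋃ j ∈ (Finset.univ : Finset (Fin J)), (ρ j).domain) = ⋃ j, R j := by
        simp only [Finset.mem_univ, iUnion_true, hρd]
      rw [h1]
      exact hnull
    · intro i _ j _ hij
      rw [hρd, hρd, disjoint_iff_inter_eq_empty.mp (hdisj hij), measure_empty]
  -- each run is a relation: the open-band move with the primitive `H`
  have hρ : ∀ j, KZ.of (ρ j) ∈ KZ.relations := by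
    intro j
    have hIcc : ∀ x ∈ S j, Icc (a j x) (b j x) ⊆
        closure {s : ℝ | (Fin.snoc x s : Fin (n + 1) → ℝ) ∈ r.domain} := fun x hx =>
      Icc_subset_closure_fibre (hab j x hx) (hsub j x hx)
    have hband : {z : Fin (n + 1) → ℝ | Fin.init z ∈ S j ∧
        z (Fin.last n) ∈ Icc (a j (Fin.init z)) (b j (Fin.init z))} ⊆ closure r.domain := by
      intro z hz
      have h1 := hIcc (Fin.init z) hz.1 hz.2
      have h2 := snoc_mem_closure_of_mem_closure_fibre h1
      rwa [Fin.snoc_init_self] at h2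
    have hbandsa := isSemialgebraic_closedBand (n := n) (ha j) (hb j)
    exact hB n (S j) (a j) (b j) (ρ j) H (hS j) (ha j) (hb j) (hab j) ((hρd j).trans (hR j))
      (hH.mono hband hbandsa) fun x hx =>
        ⟨(hcont x).mono (hIcc x hx), hfr x _ (hfrab j x hx).1, hfr x _ (hfrab j x hx).2,
          fun t ht => hder x t (interior_maximal (hsub j x hx) isOpen_Ioo ht)⟩
  have heq : KZ.of r = (KZ.of r - ∑ j ∈ (Finset.univ : Finset (Fin J)), KZ.of (ρ j)) +
      ∑ j ∈ (Finset.univ : Finset (Fin J)), KZ.of (ρ j) := by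
    abel
  rw [heq]
  exact add_mem hsum (sum_mem fun j _ => hρ j)


/-- **`KZStokes`** (route `GaussManinCertificates`, crux stmt-KontsevichZagierPeriods-3012): band
Newton–Leibniz generates Stokes's formula on every bounded `ℚ`-semialgebraic domain — the glue
`KZStokes_of_subs` applied to the two proved pieces `semialgebraicFibreRuns` and `kzStokesBand`.
[Kontsevich–Zagier 2001, §1.2, rules 1) and 3); Basu–Pollack–Roy 2006, Cor. 5.7] -/
theorem KZStokes_proof :
    Summit.KontsevichZagierPeriods.KontsevichZagierPeriods.Theses.GaussManinCertificates.KZStokes :=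
  KZStokes_of_subs semialgebraicFibreRuns kzStokesBand

end Summit.KontsevichZagierPeriods.GaussManinCertificates
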